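import Summits.CriticalPhenomena.CardyFormulaZ2.Theorems.CardyComplexConeCoherentMorera
import Summits.CriticalPhenomena.CardyFormulaZ2.Theorems.CardyComplexConeSLESixFamiliesGiveCardy
import Summits.CriticalPhenomena.CardyFormulaZ2.Cruxes.ParafermionToSLESixFamilies.Disproof
import HarnessLib

/-!
# Summit-strength certificate for crux `ParafermionToSLESixFamilies` (stmt-CriticalPhenomena-11389) — redirect strategist r1

The theorem(s) that make crux #5 of route `CardyComplexCone` SUMMIT-STRENGTH, for the tribunal (all sorry-free, over LANDED
theorems only: `CoherentMorera_proof` = item 11388 closed, `SLESixFamiliesGiveCardy_of` = item 9654 closed, `Disproof.lean` §0/§5):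

* `crux_iff_blockC_of_thesis` — GIVEN THE ROUTE'S OWN THESIS X = EdgeCoherence ∧ EdgePrecompact (its two other open cruxes,
  the binders of `closes` besides #5), crux #5 is EQUIVALENT to its bare conclusion, block C = "chordal SLE₆ for bond-ℤ² along
  every discretisation family of every Dobrushin domain" (the hypotheses A, B of #5 are exactly CoherentMorera's output, proved
  from X; so inside the route they carry no information #5 could use — and by `Disproof.crux_iff_conjecture_of_holoWorld` they
  carry none in ANY holomorphic world either).
* `blockC_iff_conjecture` — block C is literally the open named conjecture `SLE6LimitZ2AllDiscretisations` (DCS 2012 Conj. 8.8 at q = 1).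
* `summit_of_blockC` — block C ALONE gives the sub-problem statement `CardyFormulaZ2` (item 9654, proved): C ≥ S outright.
* `crux_of_conjecture'` / `summit_of_conjecture` — the tribunal's T1 "dominating hypothesis" form: H := SLE6LimitZ2AllDiscretisations
  gives the crux (hypotheses unused) AND gives S alone.
* `summit_of_crux_of_thesis` — hence, relative to the route, #5 finishes the summit: X → (#5 → S) (this is `closes` re-derived), and
  conversely S reaches #5 only through the beyond-summit lift S → C (Camia–Newman on ℤ², no theorem of the tree; child 5 of the r1
  split): `crux_of_lift_of_summit`.

Reading for the tribunal: #5 ≡ C (given X, or in any holomorphic world) and C = S ∧ (S → C) with S → C not in the tree — #5 is AT LEAST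
the summit and strictly MORE in content (the curve law beyond crossing probabilities). No line for #5 can be "short of the summit";
the honest object is the r1 decomposition (children 1–4 ⊢ S, child 5 = S → C), certified in Sketch.lean / Bridge.lean / GlueR1.lean.
-/

namespace Summit.CriticalPhenomena.CardyFormulaZ2.Cruxes.ParafermionToSLESixFamilies.SummitStrength

open Summit.CriticalPhenomena.CardyFormulaZ2.Theses.CardyComplexCone
  (EdgeCoherence EdgePrecompact CoherentMorera ParafermionToSLESixFamilies SLESixFamiliesGiveCardy)
open Summit.CriticalPhenomena.CardyFormulaZ2.Cruxes.ParafermionToSLESixFamilies.Disproof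
  (WeakHolFamilies PrecompactFamilies SLESixAllFamilies crux_iff slesixAllFamilies_iff_conjecture of_conjecture)
open Summit.CriticalPhenomena.CardyFormulaZ2.Cruxes.CoherentMorera.FinitaryGreenPairing (CoherentMorera_proof)
open Summit.CriticalPhenomena.CardyFormulaZ2.Cruxes.SLESixFamiliesGiveCardy.CollarTouchSandwich (SLESixFamiliesGiveCardy_of)

/-- The route's thesis X produces BOTH hypotheses of crux #5 (CoherentMorera, item 11388, PROVED). -/
theorem hypotheses_of_thesis (hC : EdgeCoherence) (hP : EdgePrecompact) : WeakHolFamilies ∧ PrecompactFamilies :=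
  ⟨(CoherentMorera_proof hC hP).1, (CoherentMorera_proof hC hP).2⟩

/-- **Given the route's thesis, crux #5 is equivalent to its bare conclusion C** (SLE₆ for every family of every domain). -/
theorem crux_iff_blockC_of_thesis (hC : EdgeCoherence) (hP : EdgePrecompact) :
    ParafermionToSLESixFamilies ↔ SLESixAllFamilies := by
  rw [crux_iff]
  exact ⟨fun h => h (hypotheses_of_thesis hC hP).1 (hypotheses_of_thesis hC hP).2, fun h _ _ => h⟩

/-- Block C is the open named conjecture `SLE6LimitZ2AllDiscretisations` (Disproof §0). -/
theorem blockC_iff_conjecture :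
    SLESixAllFamilies ↔ Literature.Probability.Percolation.SLE6LimitZ2AllDiscretisations :=
  slesixAllFamilies_iff_conjecture

/-- **C ≥ S outright**: block C alone gives the sub-problem statement (item 9654, PROVED). -/
theorem summit_of_blockC (h : SLESixAllFamilies) : _root_.CardyFormulaZ2 :=
  SLESixFamiliesGiveCardy_of h

/-- T1, dominating-hypothesis form (i): the conjecture gives the crux with both hypotheses unused. -/
theorem crux_of_conjecture' (h : Literature.Probability.Percolation.SLE6LimitZ2AllDiscretisations) :
    ParafermionToSLESixFamilies :=
  of_conjecture h

/-- T1, dominating-hypothesis form (ii): the same conjecture gives the summit ALONE. -/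
theorem summit_of_conjecture (h : Literature.Probability.Percolation.SLE6LimitZ2AllDiscretisations) :
    _root_.CardyFormulaZ2 :=
  summit_of_blockC (blockC_iff_conjecture.2 h)

/-- **Relative to the route, #5 finishes the summit**: X → (#5 → S) (= the route's `closes`, re-derived from landed theorems). -/
theorem summit_of_crux_of_thesis (hC : EdgeCoherence) (hP : EdgePrecompact) (h5 : ParafermionToSLESixFamilies) :
    _root_.CardyFormulaZ2 :=
  summit_of_blockC ((crux_iff_blockC_of_thesis hC hP).1 h5)

/-- … and given X, #5 is exactly "the summit plus the beyond-summit lift": (S ∧ (S → C)) ↔ #5. -/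
theorem crux_iff_summit_and_lift_of_thesis (hC : EdgeCoherence) (hP : EdgePrecompact) :
    ParafermionToSLESixFamilies ↔ (_root_.CardyFormulaZ2 ∧ (_root_.CardyFormulaZ2 → SLESixAllFamilies)) := by
  rw [crux_iff_blockC_of_thesis hC hP]
  exact ⟨fun h => ⟨summit_of_blockC h, fun _ => h⟩, fun h => h.2 h.1⟩

/-- The converse direction S → #5 goes only through the lift S → C (Camia–Newman on ℤ²; child 5 of the r1 split; no theorem
of the tree): with it, S gives the crux (hypotheses unused). -/
theorem crux_of_lift_of_summit (lift : _root_.CardyFormulaZ2 → SLESixAllFamilies) (hS : _root_.CardyFormulaZ2) :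
    ParafermionToSLESixFamilies :=
  crux_iff.2 fun _ _ => lift hS

end Summit.CriticalPhenomena.CardyFormulaZ2.Cruxes.ParafermionToSLESixFamilies.SummitStrength
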